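import Literature.NumberTheory.EllipticCurves.BSDQuadraticDescentCasselsPairingProofs
import Mathlib.GroupTheory.PGroup
import HarnessLib

/-!
# Route IsogenyRedei, crux `PencilSelmerDictionary` (stmt-Parity-11584), line `toric-node-vacuity-cassels`:
# stub F1a `stub_finiteAdjointParity` — parity of kernels for adjoint maps between finite `p`-groups

Pure algebra (Milne, *Arithmetic Duality Theorems*, proof of Thm. I.7.3, p. 98, abstract form). Let `T`,
`T'` be finite abelian `p`-groups carrying alternating bi-additive pairings `B`, `B'` with values in
`ℚ/ℤ = AddCircle (1 : ℚ)` and trivial left kernels, and let `f : T → T'`, `g : T' → T` be adjoint: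
`B' (f t) t' = B t (g t')`. Then the exponents of `p` in `#ker f` and `#ker g` have the same parity.

Proof: `#T = #ker f · #f(T)` (first isomorphism theorem); `[T' : f(T)] = #ker g` (tree
`index_range_eq_natCard_ker_of_adjoint`: `ker g` is the right annihilator of `f(T)`; the right
nondegeneracy of `B` it needs follows from left nondegeneracy and alternation, `B x y = -B y x`), so
`#T' = #f(T) · #ker g`; `#T` and `#T'` are perfect squares (tree
`isSquare_natCard_of_alternating_addCircle`, Silverman AEC Ex. 10.20); all four numbers are powers of
`p` (`IsPGroup.iff_card` through `Multiplicative`), hence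
`log_p #ker f ≡ log_p #f(T) ≡ log_p #ker g (mod 2)`.

No definitions, no named facts. [folklore]
-/

noncomputable section

open scoped Classical

universe v

namespace Summit.Parity.BatemanHorn.Theorems.PencilSelmerDictionary

open Literature.NumberTheory.EllipticCurves

/-- A finite abelian group all of whose elements are killed by powers of the prime `p` has order a
power of `p` (`IsPGroup.iff_card` for `Multiplicative T`). [folklore] -/
theorem natCard_eq_prime_pow_of_forall_pow_nsmul_eq_zero (p : ℕ) [Fact p.Prime] {T : Type v}
    [AddCommGroup T] [Finite T] (hT : ∀ t : T, ∃ n : ℕ, p ^ n • t = 0) :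
    ∃ n : ℕ, Nat.card T = p ^ n := by
  have hPG : IsPGroup p (Multiplicative T) := fun t ↦ by
    obtain ⟨n, hn⟩ := hT (Multiplicative.toAdd t)
    exact ⟨n, Multiplicative.toAdd.injective (by rwa [toAdd_pow, toAdd_one])⟩
  obtain ⟨n, hn⟩ := IsPGroup.iff_card.mp hPG
  exact ⟨n, hn⟩

/-- If `a * b = p ^ n` for a prime `p`, then `a = p ^ i`, `b = p ^ j` with `i + j = n`. [folklore] -/
theorem exists_eq_prime_pow_of_mul_eq_prime_pow {p a b n : ℕ} (hp : p.Prime) (h : a * b = p ^ n) :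
    ∃ i j : ℕ, a = p ^ i ∧ b = p ^ j ∧ i + j = n := by
  obtain ⟨i, -, rfl⟩ := (Nat.dvd_prime_pow hp).mp (Dvd.intro b h)
  obtain ⟨j, -, rfl⟩ := (Nat.dvd_prime_pow hp).mp (Dvd.intro_left (p ^ i) h)
  refine ⟨i, j, rfl, rfl, Nat.pow_right_injective hp.two_le ?_⟩
  simpa only [← pow_add] using h

/-- A perfect square which is a power `p ^ n` of a prime `p` has even exponent `n`. [folklore] -/
theorem even_of_isSquare_prime_pow {p n : ℕ} (hp : p.Prime) (h : IsSquare (p ^ n)) : Even n := by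
  obtain ⟨r, hr⟩ := h
  obtain ⟨i, j, rfl, h', hij⟩ := exists_eq_prime_pow_of_mul_eq_prime_pow hp hr.symm
  have hij' : i = j := Nat.pow_right_injective hp.two_le h'
  exact ⟨i, by rw [← hij, hij']⟩

/-- **Stub F1a — parity of kernels for adjoint maps between finite `p`-groups (pure algebra).** `T`, `T'`
finite abelian `p`-groups with alternating NONDEGENERATE bi-additive `ℚ/ℤ`-valued pairings `B`, `B'`, and
`f : T → T'`, `g : T' → T` adjoint (`B' (f t) t' = B t (g t')`). Then `log_p #ker f ≡ log_p #ker g (mod 2)`.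
Proof: `#T = #ker f · #f(T)`, `[T' : f(T)] = #ker g` (tree `index_range_eq_natCard_ker_of_adjoint`; right
nondegeneracy of `B` from alternation), so `#T' = #f(T) · #ker g`; `#T`, `#T'` are squares (tree
`isSquare_natCard_of_alternating_addCircle`); all these cards are powers of `p`, so the exponents of
`#ker f` and `#ker g` have the same parity (Milne, *ADT*, proof of Thm. I.7.3, p. 98). [folklore] -/
theorem stub_finiteAdjointParity (p : ℕ) [Fact p.Prime] {T T' : Type v} [AddCommGroup T] [AddCommGroup T']
    [Finite T] [Finite T']
    (hT : ∀ t : T, ∃ n : ℕ, p ^ n • t = 0) (hT' : ∀ t' : T', ∃ n : ℕ, p ^ n • t' = 0)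
    (f : T →+ T') (g : T' →+ T)
    (B : T →+ T →+ AddCircle (1 : ℚ)) (B' : T' →+ T' →+ AddCircle (1 : ℚ))
    (halt : ∀ t, B t t = 0) (halt' : ∀ t', B' t' t' = 0)
    (hnd : ∀ x, (∀ y, B x y = 0) → x = 0) (hnd' : ∀ x', (∀ y', B' x' y' = 0) → x' = 0)
    (hadj : ∀ t t', B' (f t) t' = B t (g t')) :
    Nat.log p (Nat.card f.ker) % 2 = Nat.log p (Nat.card g.ker) % 2 := by
  have hp : p.Prime := Fact.out
  -- the orders of `T`, `T'` are powers of `p` and perfect squares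
  obtain ⟨a, ha⟩ := natCard_eq_prime_pow_of_forall_pow_nsmul_eq_zero p hT
  obtain ⟨b, hb⟩ := natCard_eq_prime_pow_of_forall_pow_nsmul_eq_zero p hT'
  have hae : Even a :=
    even_of_isSquare_prime_pow hp (ha ▸ isSquare_natCard_of_alternating_addCircle T B halt hnd)
  have hbe : Even b :=
    even_of_isSquare_prime_pow hp (hb ▸ isSquare_natCard_of_alternating_addCircle T' B' halt' hnd')
  -- an alternating pairing is antisymmetric, so `B` also has trivial right kernel
  have hanti : ∀ x y, B x y = -B y x := fun x y ↦ by
    have h := halt (x + y)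
    simp only [map_add, AddMonoidHom.add_apply, halt x, halt y, zero_add, add_zero] at h
    rw [eq_neg_iff_add_eq_zero]
    first
    | exact h
    | rwa [add_comm] at h
  have hndr : ∀ y, (∀ x, B x y = 0) → y = 0 := fun y hy ↦
    hnd y fun x ↦ by rw [hanti y x, hy x, neg_zero]
  -- `#ker f · #f(T) = #T` and `#f(T) · #ker g = #T'`
  have h1 : Nat.card f.ker * Nat.card f.range = p ^ a := by
    rw [← ha, ← AddSubgroup.index_ker, AddSubgroup.card_mul_index]
  have h2 : Nat.card f.range * Nat.card g.ker = p ^ b := by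
    rw [← hb, ← index_range_eq_natCard_ker_of_adjoint B B' hndr hnd' f g hadj,
      AddSubgroup.card_mul_index]
  -- read off the exponents
  obtain ⟨i, j, hi, hj, hij⟩ := exists_eq_prime_pow_of_mul_eq_prime_pow hp h1
  obtain ⟨j', k, hj', hk, hjk⟩ := exists_eq_prime_pow_of_mul_eq_prime_pow hp h2
  have hjj : j' = j := Nat.pow_right_injective hp.two_le (hj'.symm.trans hj)
  rw [hi, hk, Nat.log_pow hp.one_lt, Nat.log_pow hp.one_lt]
  obtain ⟨m, hm⟩ := hae
  obtain ⟨m', hm'⟩ := hbe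
  omega

end Summit.Parity.BatemanHorn.Theorems.PencilSelmerDictionary

end
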